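import Mathlib
import Summits.ValiantsHypothesis.ValiantsHypothesis.Theses.ValuativeGCT
import Literature.Computability.AlgebraicComplexity.MultiplicityObstructionsProofs
import Literature.NumberTheory.DiophantineGeometry.SchurWeylPlethysmOrbitWeightsProofs
import Summits.ValiantsHypothesis.ValiantsHypothesis.Theorems.ValuativeGCTValuativeFlipSemigroupFloor
import Summits.ValiantsHypothesis.ValiantsHypothesis.Theorems.ValuativeGCTNoValuativeFlipOutsideKL

/-!
# Plethysm-table constraints on seed data, along rays (crux `ValuativeGCT.ValuativeFlip`, stmt-ValiantsHypothesis-12624)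

Wall-breaker axis 6/16 of the crux: "plethysm tables for `seedRichness` (small cases certified)".
The per-side stub `stub_seedRichness` of line `big-cell-semigroup-floor`
(`Cruxes/ValuativeFlip/Lines/big_cell_semigroup_floor.lean`) asks, at every window position
`n ≤ m`, for a SEED DATUM `(ν, D, F)`: `D + 1 > n⁴/4` ALGEBRAICALLY INDEPENDENT highest-weight
vectors `F i` of one common weight `ν` in `ℂ[Δ_m(X₀₀^{m-n} per_n)]`
(`orbitCoordRep (paddedPerFormLex ℂ n m) m`).  The sibling file
`ValuativeGCTValuativeFlipSeedCeiling.lean` (axis k2, landed independently the same hour) proves the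
`k = 1` ceiling chain `D + 1 ≤ mult_ν ≤ a_ν` for algebraically independent families and the
Kadish–Landsberg pinning of `ν`.  This file (not importing it, to stay buildable while the farm
catches up; no declaration is repeated) adds what a plethysm TABLE says beyond one entry:

* `card_le_orbitMultiplicity_of_linearIndependent`, `card_le_plethysmCoeff_of_linearIndependent` —
  the ceilings for LINEARLY independent one-weight families (linear richness is what a multiplicity
  is; algebraic independence is not needed for the ceiling);
* `choose_le_plethysmCoeff_nsmul_of_algebraicIndependent` — the RAY CEILING: a seed datum
  `(χ, D, F)` in `ℂ[Δ_m(f)]` (`f` a form of degree `m ≠ 0`) forces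
  `C(k + D, D) ≤ plethysmCoeff ℂ σ m (k • χ)` for EVERY `k` (landed semigroup floor
  `C(k+D, D) ≤ mult_{k•χ}`, p98674, followed by BLMW Prop. 4.4.1): along the ray `ℕ χ` the table
  entries must grow with exponent `≥ D`, not merely exceed `D` once;
* `seed_table_constraints_paddedPer` — at the padded permanent: the seed weight is `ν = λ*`,
  `λ ⊢ m·d` with `ℓ(λ) ≤ m²` (BLMW (5.2.2)), in the Kadish–Landsberg cone `ℓ(λ) ≤ n² + 1`,
  `λ₁ ≥ d(m - n)` (tree `kadishLandsberg_of_hasHighestWeight_paddedPerOrbitRep`), with the ray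
  ceiling at every `k` — the index set and the test of the axis's table, with the `ℓ(λ) ≤ m²` side
  condition that the classical reading `a_λ(d, m) = plethysmCoeffOfPartition` needs
  (`Literature.RepresentationTheory.GeneralLinear.plethysmCoeff_partitionWeightLex_eq_plethysmCoeffOfPartition`,
  p112323; classical form in `ValuativeGCTValuativeFlipSeedTableClassical.lean`);
* `seedRichness_threshold_le_plethysmCoeff`, `seedRichness_threshold_le_orbitMultiplicity` — with
  `n⁴/4 ≤ D`: `n⁴/4 + 1 ≤ a_ν` and `n⁴/4 + 1 ≤ mult_ν ℂ[Δ_m(pp)]` (seed richness at `ν` is at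
  least as hard as a per-side multiplicity lower bound of size `n⁴/4` at `ν`).

Certified small tables (kit job j018831 of this seat, j018529 of axis k2; AXIS.md): every
Kadish–Landsberg entry is `1` in degrees `d ≤ 4` for `m = 3` and `d ≤ 3` for `m ∈ {4, 5}`;
`max_λ a_λ(d[3]) = 2, 2, 4, 7, 11, 24, 64` for `d = 5..11`, so a seed of richness `21 = ⌊3⁴/4⌋ + 1`
at `n = 3` has degree `d ≥ 10`; `d_min(4,4) = 8` (threshold 65), `d_min(5,5) = 7` (threshold 157).
Within the computed range (`|λ| ≤ 45`) the ray ceiling never cuts below the `k = 1` entry test.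
What no ceiling gives is a floor: the existence of rich seed families is untouched.

Sources: BLMW, SIAM J. Comput. 40 (2011), §4.4 (Prop. 4.4.1), (5.2.2), §5.2; Kadish–Landsberg,
Comm. Algebra 42 (2014); Bürgisser–Ikenmeyer–Panova, J. AMS 32 (2019), Thm. 4.9; this crux's
`Theorems/ValuativeGCTValuativeFlipSemigroupFloor.lean` (p98674),
`Theorems/ValuativeGCTNoValuativeFlipOutsideKL.lean`, `Theorems/ValuativeGCTValuativeFlipSeedCeiling.lean`.
-/

-- `Summit.ValiantsHypothesis.ValiantsHypothesis.…` repeats a component by the D-0017 layout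
-- (single-conjunct summit), which the `dupNamespace` linter flags; the name is mandated.
set_option linter.dupNamespace false

namespace Summit.ValiantsHypothesis.ValiantsHypothesis.Theorems.ValuativeFlip

open scoped BigOperators
open Literature.NumberTheory.DiophantineGeometry Literature.Computability.AlgebraicComplexity

/-! ## Linear richness is bounded by the multiplicity, hence by the plethysm coefficient -/

/-- **Linear richness ≤ multiplicity.** In the coordinate ring `ℂ[Δ_m(f)]` of the orbit closure of a
form `f` (`m ≠ 0`), a LINEARLY independent family of highest-weight vectors of weight `χ` has at
most `mult_χ ℂ[Δ_m(f)] = orbitMultiplicity ℂ f m χ` members: the family spans a subspace of the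
highest-weight space, which is finite-dimensional because a weight pins the degree
(`finiteDimensional_highestWeightSpace_orbitCoordRep_holds`, BLMW 2011 §5.2).  (The algebraically
independent case is `card_le_orbitMultiplicity_of_algebraicIndependent` of the sibling file.)
[folklore] -/
theorem card_le_orbitMultiplicity_of_linearIndependent {σ : Type} [Fintype σ] [LinearOrder σ]
    (f : MvPolynomial σ ℂ) {m : ℕ} (hm : m ≠ 0) (χ : Weight σ) {ι : Type} [Fintype ι]
    (F : ι → OrbitCoordRing f m) (hF : ∀ i, F i ∈ highestWeightSpace (orbitCoordRep f m) χ)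
    (hli : LinearIndependent ℂ F) : Fintype.card ι ≤ orbitMultiplicity ℂ f m χ := by
  haveI : FiniteDimensional ℂ (highestWeightSpace (orbitCoordRep f m) χ) :=
    finiteDimensional_highestWeightSpace_orbitCoordRep_holds (k := ℂ) f hm χ
  have hspan : Submodule.span ℂ (Set.range F) ≤ highestWeightSpace (orbitCoordRep f m) χ :=
    Submodule.span_le.mpr (Set.range_subset_iff.mpr hF)
  have h1 : Module.finrank ℂ (Submodule.span ℂ (Set.range F)) = Fintype.card ι :=
    finrank_span_eq_card hli
  rw [orbitMultiplicity, hwMultiplicity, ← h1]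
  exact Submodule.finrank_mono hspan

/-- **Linear richness ≤ plethysm coefficient.** For a form `f` homogeneous of degree `m ≠ 0`, a
linearly independent family of highest-weight vectors of weight `χ` in `ℂ[Δ_m(f)]` has at most
`plethysmCoeff ℂ σ m χ` members (the multiplicity of `χ` in the ambient ring `ℂ[Sym^m ℂ^σ]`):
`card_le_orbitMultiplicity_of_linearIndependent` and BLMW's bound
`mult_χ ℂ[Δ_m(f)] ≤ mult_χ ℂ[Sym^m]` (tree: `orbitMultiplicity_le_plethysmCoeff_holds`).
BLMW 2011 Prop. 4.4.1, §5.2. -/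
theorem card_le_plethysmCoeff_of_linearIndependent {σ : Type} [Fintype σ] [LinearOrder σ]
    (f : MvPolynomial σ ℂ) {m : ℕ} (hm : m ≠ 0) (hf : f.IsHomogeneous m) (χ : Weight σ)
    {ι : Type} [Fintype ι] (F : ι → OrbitCoordRing f m)
    (hF : ∀ i, F i ∈ highestWeightSpace (orbitCoordRep f m) χ) (hli : LinearIndependent ℂ F) :
    Fintype.card ι ≤ plethysmCoeff ℂ σ m χ :=
  (card_le_orbitMultiplicity_of_linearIndependent f hm χ F hF hli).trans
    (orbitMultiplicity_le_plethysmCoeff_holds f hm hf χ)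

/-! ## The ray ceiling: plethysm along `ℕ χ` must grow with exponent `≥ D` -/

/-- **Ray ceiling.** `D + 1` algebraically independent highest-weight vectors of weight `χ` in
`ℂ[Δ_m(f)]` (`f` homogeneous of degree `m ≠ 0`) force, for EVERY `k`,
`C(k + D, D) ≤ plethysmCoeff ℂ σ m (k • χ)`: the landed semigroup floor
`C(k + D, D) ≤ mult_{k•χ} ℂ[Δ_m(f)]` (`semigroupFloor`, this crux, p98674) followed by BLMW's
plethysm bound.  Read as a table constraint: along the ray `k ↦ a(k • χ)` the plethysm
coefficients grow at least like `k^D / D!`. [this crux; BLMW 2011 Prop. 4.4.1] -/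
theorem choose_le_plethysmCoeff_nsmul_of_algebraicIndependent {σ : Type} [Fintype σ]
    [LinearOrder σ] (f : MvPolynomial σ ℂ) {m : ℕ} (hm : m ≠ 0) (hf : f.IsHomogeneous m)
    (χ : Weight σ) (D : ℕ) (F : Fin (D + 1) → OrbitCoordRing f m)
    (hF : ∀ i, F i ∈ highestWeightSpace (orbitCoordRep f m) χ) (hind : AlgebraicIndependent ℂ F)
    (k : ℕ) : (k + D).choose D ≤ plethysmCoeff ℂ σ m (k • χ) :=
  (semigroupFloor f hm χ D F hF hind k).trans (orbitMultiplicity_le_plethysmCoeff_holds f hm hf _)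

/-! ## The padded permanent: where in the table a seed weight can sit -/

/-- **Table constraints for `stub_seedRichness`.**  Let `(ν, D, F)` be a seed datum of the padded
permanent at a window position `n ≤ m`: `D + 1` algebraically independent highest-weight vectors
of weight `ν` in `ℂ[Δ_m(X₀₀^{m-n} per_n)]` (the hypothesis is verbatim the conclusion of
`stub_seedRichness` / the premise of `stub_detCensus` of line `big-cell-semigroup-floor`).  Then
`ν = λ*` (`(Weight.dualOfPartition (m*m) λ).toMatIdx`) for a partition `λ ⊢ m·d` of the degree
`d` pinned by `ν`, with at most `m²` parts (BLMW (5.2.2), tree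
`exists_eq_toMatIdx_of_hasHighestWeight_paddedPerOrbitRep`) and lying in the Kadish–Landsberg
cone — at most `n² + 1` parts and first part `λ₁ ≥ d (m - n)` (Kadish–Landsberg 2014 / BIP 2019
Thm. 4.9, tree `kadishLandsberg_of_hasHighestWeight_paddedPerOrbitRep`) — and the plethysm
coefficients along the ray of `ν` dominate the binomials: `C(k + D, D) ≤ plethysmCoeff (k • ν)` for
every `k` (ray ceiling above).  This is the index set and the threshold test of the axis's table,
with the side condition `ℓ(λ) ≤ m²` under which the entry is the classical `a_λ(d, m)`. -/
theorem seed_table_constraints_paddedPer {n m : ℕ} [NeZero m] (hnm : n ≤ m)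
    (ν : Weight (MatIdx m)) (D : ℕ)
    (h : ∃ F : Fin (D + 1) → OrbitCoordRing (paddedPerFormLex ℂ n m) m,
      (∀ i, F i ∈ highestWeightSpace (orbitCoordRep (paddedPerFormLex ℂ n m) m) ν) ∧
      AlgebraicIndependent ℂ F) :
    ∃ (d : ℕ) (lam : Nat.Partition (m * d)),
      lam.parts.card ≤ m * m ∧ lam.parts.card ≤ n ^ 2 + 1 ∧ d * (m - n) ≤ lam.parts.sup ∧
      ν = (Weight.dualOfPartition (m * m) lam).toMatIdx ∧
      ∀ k : ℕ, (k + D).choose D ≤ plethysmCoeff ℂ (MatIdx m) m (k • ν) := by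
  obtain ⟨F, hF, hind⟩ := h
  have hocc : HasHighestWeight (paddedPerOrbitRep ℂ n m) ν :=
    (hasHighestWeight_iff_exists _ _).mpr ⟨F 0, hind.linearIndependent.ne_zero 0, hF 0⟩
  obtain ⟨d, lam, hcard, hν⟩ := exists_eq_toMatIdx_of_hasHighestWeight_paddedPerOrbitRep hocc
  have hKL := Summit.ValiantsHypothesis.ValiantsHypothesis.Theorems.NoValuativeFlip.kadishLandsberg_of_hasHighestWeight_paddedPerOrbitRep
    hnm lam hcard (hν ▸ hocc)
  refine ⟨d, lam, hcard, hKL.2, hKL.1, hν, fun k => ?_⟩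
  exact choose_le_plethysmCoeff_nsmul_of_algebraicIndependent (paddedPerFormLex ℂ n m)
    (NeZero.ne m) (paddedPerFormLex_isHomogeneous (k := ℂ) hnm) ν D F hF hind k

/-- **The richness threshold against the table entry.**  A seed datum of `stub_seedRichness` at
`(n, m)` — weight `ν`, richness `D` with `n⁴/4 ≤ D`, `D + 1` algebraically independent
highest-weight vectors of weight `ν` in `ℂ[Δ_m(X₀₀^{m-n} per_n)]` — forces the plethysm
coefficient of `ν` in `ℂ[Sym^m ℂ^{m²}]` to be at least `n⁴/4 + 1`.  So in the axis's table only
entries `a_λ(d[m]) ≥ ⌊n⁴/4⌋ + 1` on Kadish–Landsberg shapes can carry a seed weight; all smaller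
entries — in particular every multiplicity-free degree (`d ≤ 4` for `m = 3`, `d ≤ 3` for
`m ∈ {4, 5}`, certified) — are excluded. [this file] -/
theorem seedRichness_threshold_le_plethysmCoeff {n m : ℕ} [NeZero m] (hnm : n ≤ m)
    (ν : Weight (MatIdx m)) (D : ℕ) (hD : n ^ 4 / 4 ≤ D)
    (h : ∃ F : Fin (D + 1) → OrbitCoordRing (paddedPerFormLex ℂ n m) m,
      (∀ i, F i ∈ highestWeightSpace (orbitCoordRep (paddedPerFormLex ℂ n m) m) ν) ∧
      AlgebraicIndependent ℂ F) :
    n ^ 4 / 4 + 1 ≤ plethysmCoeff ℂ (MatIdx m) m ν := by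
  obtain ⟨F, hF, hind⟩ := h
  have h1 := card_le_plethysmCoeff_of_linearIndependent (paddedPerFormLex ℂ n m) (NeZero.ne m)
    (paddedPerFormLex_isHomogeneous (k := ℂ) hnm) ν F hF hind.linearIndependent
  rw [Fintype.card_fin] at h1
  omega

/-- **The richness threshold against the per-side multiplicity itself** (no plethysm): a seed
datum with `n⁴/4 ≤ D` forces `n⁴/4 + 1 ≤ mult_ν ℂ[Δ_m(X₀₀^{m-n} per_n)]` — seed richness at `ν`
is at least as hard as a per-side MULTIPLICITY lower bound of size `n⁴/4` at `ν` (the quantity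
every line of this crux lacks above the bottom of the window).
[this file] -/
theorem seedRichness_threshold_le_orbitMultiplicity {n m : ℕ} [NeZero m]
    (ν : Weight (MatIdx m)) (D : ℕ) (hD : n ^ 4 / 4 ≤ D)
    (h : ∃ F : Fin (D + 1) → OrbitCoordRing (paddedPerFormLex ℂ n m) m,
      (∀ i, F i ∈ highestWeightSpace (orbitCoordRep (paddedPerFormLex ℂ n m) m) ν) ∧
      AlgebraicIndependent ℂ F) :
    n ^ 4 / 4 + 1 ≤ orbitMultiplicity ℂ (paddedPerFormLex ℂ n m) m ν := by
  obtain ⟨F, hF, hind⟩ := h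
  have h1 := card_le_orbitMultiplicity_of_linearIndependent (paddedPerFormLex ℂ n m)
    (NeZero.ne m) ν F hF hind.linearIndependent
  rw [Fintype.card_fin] at h1
  omega

end Summit.ValiantsHypothesis.ValiantsHypothesis.Theorems.ValuativeFlip
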